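import Summits.Ventures.PercRepro.C025ProfileGenGeom
import Summits.Ventures.PercRepro.C025ProfileGenCapCA
import Summits.Ventures.PercRepro.C025ProfileRankFourCapA

/-!
# Lines inside a rank-4 set — the geometry behind (Cap) for the row (2,4) (night-3 g9)

NIGHT3-G9-TWO-FOUR-CERTIFICATE.md §4.1: the facts about rank-`2` subsets (lines) of a rank-`4` set `S` of a simple
matroid used by (Cap) for `|S| ≥ 6` (C025ProfileFourCapBig):
* `card_add_card_le_of_inter_le_one` — two lines of `S` with at most one common point have `|B| + |B′| ≤ |S|`
  (two lines through a point span a plane, so they cannot cover a rank-`4` set);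
* `subset_clF_of_two_le_card_inter` — two rank-`2` sets with two common points lie on one line;
* `clF_inter_eq_of_sdiff_two` — a line with exactly two points of `S` outside it contains every point of `S` on its
  closure (else `S` is a line plus a point);
* `closure_pair_eq_closure_of_eRk_two`, `eRk_singleton_eq_one_of_simple`, `card_sdiff_ge_two_of_eRk_two`;
* `not_three_lines_of_card_six` — three pairwise different `3`-point lines cannot lie in six points of rank `4`.
Nothing here mentions the rule `w24`.
-/

open scoped Matroid

namespace PercRepro

open Set Finset ThmH

section FourGeom

variable {α : Type} [DecidableEq α] {M : Matroid α} [M.Finite]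

omit [DecidableEq α] in
/-- In a simple matroid a point has rank `1`. -/
theorem eRk_singleton_eq_one_of_simple (hsimple : ∀ T ⊆ M.E, T.encard ≤ 2 → M.Indep T) {x : α} (hx : x ∈ gr M) :
    M.eRk ({x} : Set α) = 1 := by
  have hxE : x ∈ M.E := by rw [← coe_gr]; exact_mod_cast hx
  have hI : M.Indep ({x} : Set α) := hsimple _ (Set.singleton_subset_iff.2 hxE) (by simp)
  rw [hI.eRk_eq_encard, Set.encard_singleton]

/-- **Two different lines of a rank-`4` set are short**: rank-`2` subsets `B, B′ ⊆ S` with at most one common point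
have `|B| + |B′| ≤ |S|` (they cannot cover `S`: two lines through a point span a plane). -/
theorem card_add_card_le_of_inter_le_one (hsimple : ∀ T ⊆ M.E, T.encard ≤ 2 → M.Indep T) {S B B' : Finset α}
    (hSg : S ⊆ gr M) (hS4 : M.eRk (S : Set α) = 4) (hBS : B ⊆ S) (hB'S : B' ⊆ S) (hB2 : M.eRk (B : Set α) = 2)
    (hB'2 : M.eRk (B' : Set α) = 2) (hint : (B ∩ B').card ≤ 1) : B.card + B'.card ≤ S.card := by
  have hcu : (B ∪ B').card + (B ∩ B').card = B.card + B'.card := Finset.card_union_add_card_inter B B'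
  have hle : (B ∪ B').card ≤ S.card := Finset.card_le_card (Finset.union_subset hBS hB'S)
  rcases Nat.eq_zero_or_pos (B ∩ B').card with h0 | hpos
  · omega
  · have h1 : (B ∩ B').card = 1 := by omega
    obtain ⟨a, ha⟩ := Finset.card_eq_one.1 h1
    have haS : a ∈ gr M := hSg (hBS (Finset.mem_inter.1 (by rw [ha]; exact Finset.mem_singleton_self a)).1)
    -- B ∪ B' ≠ S, else ρ(S) ≤ 3 by submodularity
    have hne : B ∪ B' ≠ S := by
      intro heq
      have hsub := M.eRk_inter_add_eRk_union_le (B : Set α) (B' : Set α)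
      rw [← Finset.coe_inter, ← Finset.coe_union, heq, hS4, ha, Finset.coe_singleton,
        eRk_singleton_eq_one_of_simple hsimple haS, hB2, hB'2] at hsub
      norm_num at hsub
    have hlt : (B ∪ B').card < S.card :=
      Finset.card_lt_card (Finset.ssubset_iff_subset_ne.2 ⟨Finset.union_subset hBS hB'S, hne⟩)
    omega

/-- **Two rank-`2` sets with two common points lie on one line**: `B′ ⊆ cl B`. -/
theorem subset_clF_of_two_le_card_inter (hsimple : ∀ T ⊆ M.E, T.encard ≤ 2 → M.Indep T) {B B' : Finset α}
    (hBg : B ⊆ gr M) (hB'g : B' ⊆ gr M) (hB2 : M.eRk (B : Set α) = 2) (hB'2 : M.eRk (B' : Set α) = 2)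
    (hint : 2 ≤ (B ∩ B').card) : B' ⊆ clF M B := by
  obtain ⟨U, hUsub, hUc⟩ := Finset.exists_subset_card_eq hint
  obtain ⟨x, y, hxy, hU⟩ := Finset.card_eq_two.1 hUc
  have hx : x ∈ B ∩ B' := hUsub (by rw [hU]; exact Finset.mem_insert_self _ _)
  have hy : y ∈ B ∩ B' := hUsub (by rw [hU]; exact Finset.mem_insert_of_mem (Finset.mem_singleton_self _))
  rw [Finset.mem_inter] at hx hy
  have h1 : clF M {x, y} = clF M B := clF_pair_eq_of_subset_line hsimple hBg hB2 hxy hx.1 hy.1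
  have h2 : clF M {x, y} = clF M B' := clF_pair_eq_of_subset_line hsimple hB'g hB'2 hxy hx.2 hy.2
  rw [← h1, h2]
  exact subset_clF_self hB'g

/-- A line of `S` with exactly two points of `S` outside it contains every point of `S` on its closure
(otherwise `S` would be a line plus one point, of rank `≤ 3`). -/
theorem clF_inter_eq_of_sdiff_two {S B : Finset α} (hSg : S ⊆ gr M) (hS4 : M.eRk (S : Set α) = 4) (hBS : B ⊆ S)
    (hB2 : M.eRk (B : Set α) = 2) (he : (S \ B).card = 2) {x : α} (hxS : x ∈ S) (hx : x ∈ clF M B) : x ∈ B := by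
  by_contra hxB
  obtain ⟨y, hy⟩ : ∃ y, S \ B = {x, y} := by
    obtain ⟨u, v, huv, hU⟩ := Finset.card_eq_two.1 he
    have hxU : x ∈ S \ B := Finset.mem_sdiff.2 ⟨hxS, hxB⟩
    rw [hU, Finset.mem_insert, Finset.mem_singleton] at hxU
    rcases hxU with rfl | rfl
    · exact ⟨v, hU⟩
    · exact ⟨u, by rw [hU, Finset.pair_comm]⟩
  have hSeq : S = insert y (insert x B) := by
    ext z
    constructor
    · intro hz
      by_cases hzB : z ∈ B
      · exact Finset.mem_insert_of_mem (Finset.mem_insert_of_mem hzB)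
      · have : z ∈ S \ B := Finset.mem_sdiff.2 ⟨hz, hzB⟩
        rw [hy, Finset.mem_insert, Finset.mem_singleton] at this
        rcases this with rfl | rfl
        · exact Finset.mem_insert_of_mem (Finset.mem_insert_self _ _)
        · exact Finset.mem_insert_self _ _
    · intro hz
      rw [Finset.mem_insert, Finset.mem_insert] at hz
      rcases hz with rfl | rfl | hzB
      · have : z ∈ S \ B := by rw [hy]; exact Finset.mem_insert_of_mem (Finset.mem_singleton_self _)
        exact (Finset.mem_sdiff.1 this).1
      · exact hxS
      · exact hBS hzB
  have hins : M.eRk ((insert x B : Finset α) : Set α) ≤ 2 := by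
    rw [← hB2, ← M.eRk_closure_eq (B : Set α)]
    apply M.eRk_mono
    rw [Finset.coe_insert]
    apply Set.insert_subset
    · rw [← coe_clF]; exact_mod_cast hx
    · exact M.subset_closure_of_subset' (Set.Subset.refl _) (by rw [← coe_gr]; exact_mod_cast hBS.trans hSg)
  have h3 : M.eRk (S : Set α) ≤ 3 := by
    rw [hSeq, Finset.coe_insert]
    calc M.eRk (insert y ((insert x B : Finset α) : Set α)) ≤ M.eRk ((insert x B : Finset α) : Set α) + 1 :=
          M.eRk_insert_le_add_one y _
      _ ≤ 2 + 1 := add_le_add hins le_rfl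
      _ = 3 := by norm_num
  rw [hS4] at h3
  norm_num at h3

/-- The closure of a rank-`2` set is the closure of any two of its points. -/
theorem closure_pair_eq_closure_of_eRk_two (hsimple : ∀ T ⊆ M.E, T.encard ≤ 2 → M.Indep T) {B : Finset α}
    (hBg : B ⊆ gr M) (hB2 : M.eRk (B : Set α) = 2) {x y : α} (hxy : x ≠ y) (hx : x ∈ B) (hy : y ∈ B) :
    M.closure ({x, y} : Set α) = M.closure (B : Set α) := by
  have h := clF_pair_eq_of_subset_line hsimple hBg hB2 hxy hx hy
  have h' := congrArg (fun T : Finset α => (T : Set α)) h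
  simp only [coe_clF, Finset.coe_pair] at h'
  exact h'

/-- **Three pairwise different `3`-point lines cannot lie in six points of rank `4`.** -/
theorem not_three_lines_of_card_six (hsimple : ∀ T ⊆ M.E, T.encard ≤ 2 → M.Indep T) {S B₁ B₂ B₃ : Finset α}
    (hSg : S ⊆ gr M) (hS4 : M.eRk (S : Set α) = 4) (hS6 : S.card = 6)
    (h1S : B₁ ⊆ S) (h2S : B₂ ⊆ S) (h3S : B₃ ⊆ S)
    (h1r : M.eRk (B₁ : Set α) = 2) (h2r : M.eRk (B₂ : Set α) = 2) (h3r : M.eRk (B₃ : Set α) = 2)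
    (h1c : B₁.card = 3) (h2c : B₂.card = 3) (h3c : B₃.card = 3)
    (h12 : (B₁ ∩ B₂).card ≤ 1) (h13 : (B₃ ∩ B₁).card ≤ 1) (h23 : (B₃ ∩ B₂).card ≤ 1) : False := by
  set U := B₁ ∪ B₂ with hU
  have hUS : U ⊆ S := Finset.union_subset h1S h2S
  have hUc : 5 ≤ U.card := by
    have := Finset.card_union_add_card_inter B₁ B₂
    rw [← hU] at this
    omega
  have h3U : (B₃ ∩ U).card ≤ 2 := by
    rw [hU, Finset.inter_union_distrib_left]
    calc (B₃ ∩ B₁ ∪ B₃ ∩ B₂).card ≤ (B₃ ∩ B₁).card + (B₃ ∩ B₂).card := Finset.card_union_le _ _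
      _ ≤ 2 := by omega
  have hnot : ¬ B₃ ⊆ U := by
    intro h
    have h' : (B₃ ∩ U).card = B₃.card := by rw [Finset.inter_eq_left.2 h]
    omega
  obtain ⟨u, huB₃, huU⟩ := Finset.not_subset.1 hnot
  have huS : u ∈ S := h3S huB₃
  -- S ∖ U = {u}
  have hSU : S \ U = {u} := by
    have hcard : (S \ U).card ≤ 1 := by
      rw [Finset.card_sdiff, Finset.inter_eq_left.2 hUS]
      omega
    have hmem : u ∈ S \ U := Finset.mem_sdiff.2 ⟨huS, huU⟩
    exact Finset.eq_singleton_iff_unique_mem.2 ⟨hmem, fun v hv => by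
      by_contra hvu
      have : 2 ≤ (S \ U).card := by
        rw [← Finset.card_pair hvu]
        exact Finset.card_le_card (by intro w hw; rw [Finset.mem_insert, Finset.mem_singleton] at hw; rcases hw with rfl | rfl; exacts [hv, hmem])
      omega⟩
  have hUc5 : U.card = 5 := by
    have := Finset.card_sdiff_add_card_eq_card hUS
    rw [hSU, Finset.card_singleton] at this
    omega
  have hint1 : (B₁ ∩ B₂).card = 1 := by
    have := Finset.card_union_add_card_inter B₁ B₂
    rw [← hU] at this
    omega
  -- ρ(U) ≤ 3 by submodularity
  obtain ⟨a, ha⟩ := Finset.card_eq_one.1 hint1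
  have haS : a ∈ gr M := hSg (h1S (Finset.mem_inter.1 (by rw [ha]; exact Finset.mem_singleton_self a)).1)
  have hU3 : M.eRk (U : Set α) ≤ 3 := by
    have hsub := M.eRk_inter_add_eRk_union_le (B₁ : Set α) (B₂ : Set α)
    rw [← Finset.coe_inter, ← Finset.coe_union, ha, Finset.coe_singleton,
      eRk_singleton_eq_one_of_simple hsimple haS, h1r, h2r] at hsub
    have h4 : (1 : ℕ∞) + M.eRk (U : Set α) ≤ 4 := by rw [hU]; exact_mod_cast hsub
    have hfin : M.eRk (U : Set α) ≠ ⊤ := (M.isRkFinite_set _).eRk_lt_top.ne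
    rw [← ENat.coe_toNat hfin] at h4 ⊢
    have h5 : 1 + (M.eRk (U : Set α)).toNat ≤ 4 := by exact_mod_cast h4
    exact_mod_cast (by omega : (M.eRk (U : Set α)).toNat ≤ 3)
  -- B₃ ∖ {u} ⊆ U with two points, whose closure contains u
  have h3e : (B₃.erase u) ⊆ U := by
    intro v hv
    rw [Finset.mem_erase] at hv
    have hvS : v ∈ S := h3S hv.2
    by_contra hvU
    have : v ∈ S \ U := Finset.mem_sdiff.2 ⟨hvS, hvU⟩
    rw [hSU, Finset.mem_singleton] at this
    exact hv.1 this
  have h3ec : (B₃.erase u).card = 2 := by rw [Finset.card_erase_of_mem huB₃, h3c]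
  obtain ⟨x, y, hxy, hxy'⟩ := Finset.card_eq_two.1 h3ec
  have hx : x ∈ B₃ := (Finset.mem_erase.1 (by rw [hxy']; exact Finset.mem_insert_self _ _)).2
  have hy : y ∈ B₃ := (Finset.mem_erase.1 (by rw [hxy']; exact Finset.mem_insert_of_mem (Finset.mem_singleton_self _))).2
  have hxU : x ∈ U := h3e (by rw [hxy']; exact Finset.mem_insert_self _ _)
  have hyU : y ∈ U := h3e (by rw [hxy']; exact Finset.mem_insert_of_mem (Finset.mem_singleton_self _))
  have hu_cl : u ∈ M.closure ({x, y} : Set α) := by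
    rw [closure_pair_eq_closure_of_eRk_two hsimple (h3S.trans hSg) h3r hxy hx hy]
    exact M.subset_closure _ (by rw [← coe_gr]; exact_mod_cast h3S.trans hSg) (by exact_mod_cast huB₃)
  have hu_clU : u ∈ M.closure (U : Set α) := by
    apply M.closure_subset_closure _ hu_cl
    intro w hw
    rw [Set.mem_insert_iff, Set.mem_singleton_iff] at hw
    rcases hw with rfl | rfl
    · exact_mod_cast hxU
    · exact_mod_cast hyU
  have hSeq : (S : Set α) = insert u (U : Set α) := by
    rw [← Finset.coe_insert]
    congr 1
    ext z
    rw [Finset.mem_insert]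
    constructor
    · intro hz
      by_cases hzU : z ∈ U
      · exact Or.inr hzU
      · left
        have : z ∈ S \ U := Finset.mem_sdiff.2 ⟨hz, hzU⟩
        rw [hSU, Finset.mem_singleton] at this
        exact this
    · rintro (rfl | hz)
      · exact huS
      · exact hUS hz
  have hS3 : M.eRk (S : Set α) ≤ 3 := by
    rw [hSeq]
    calc M.eRk (insert u (U : Set α)) ≤ M.eRk (M.closure (U : Set α)) := by
          apply M.eRk_mono
          apply Set.insert_subset hu_clU
          exact M.subset_closure _ (by rw [← coe_gr]; exact_mod_cast hUS.trans hSg)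
      _ ≤ 3 := by rw [M.eRk_closure_eq]; exact hU3
  rw [hS4] at hS3
  norm_num at hS3

omit [M.Finite] in
/-- A rank-`2` subset of `S` with at most one point of `S` outside it contradicts `ρ(S) = 4`. -/
theorem card_sdiff_ge_two_of_eRk_two {S B : Finset α} (hS4 : M.eRk (S : Set α) = 4)
    (hB2 : M.eRk (B : Set α) = 2) : 2 ≤ (S \ B).card := by
  by_contra hlt
  push Not at hlt
  have hle : M.eRk (S : Set α) ≤ 3 := by
    have hsub : (S : Set α) ⊆ (B : Set α) ∪ ((S \ B : Finset α) : Set α) := by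
      intro x hx
      rw [Set.mem_union, Finset.mem_coe, Finset.mem_coe, Finset.mem_sdiff]
      by_cases hxB : x ∈ B
      · exact Or.inl hxB
      · exact Or.inr ⟨by exact_mod_cast hx, hxB⟩
    calc M.eRk (S : Set α) ≤ M.eRk ((B : Set α) ∪ ((S \ B : Finset α) : Set α)) := M.eRk_mono hsub
      _ ≤ M.eRk (B : Set α) + M.eRk ((S \ B : Finset α) : Set α) := M.eRk_union_le_eRk_add_eRk _ _
      _ ≤ 2 + 1 := by
          apply add_le_add (le_of_eq hB2)
          calc M.eRk ((S \ B : Finset α) : Set α) ≤ ((S \ B : Finset α) : Set α).encard := M.eRk_le_encard _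
            _ = ((S \ B).card : ℕ∞) := Set.encard_coe_eq_coe_finsetCard _
            _ ≤ 1 := by exact_mod_cast Nat.lt_succ_iff.1 hlt
      _ = 3 := by norm_num
  rw [hS4] at hle
  norm_num at hle

end FourGeom

end PercRepro
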